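import Mathlib.Algebra.Group.MinimalAxioms
import Mathlib.Algebra.BigOperators.Group.List.Basic
import Mathlib.Data.ZMod.Basic
import Mathlib.Tactic.Ring
import Mathlib.Tactic.Linarith
import Mathlib.Tactic.FinCases
import HarnessLib

/-!
# Discrete Heisenberg holonomy for the triangle-torus invariant (algebraic layer)

ω-census `pub-omega`, family (b3), seat pub-omega-group gen 33.  Framing: lottery ticket; floor = certified bounds/negative
ranges.  VALUE: kernel infrastructure for the cell's Theorem B (RESULTS-g32: every partition of `ℤ_n² ∖ {pt}`, `3 ∤ n`, into
translates of `{0,e₁,e₂}` and `{0,−e₁,−e₂}` has `|#up − #down| = O(n)`), whose kernel proof is completed in the sequel files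
`TriangleTorusCochain.lean`, `TriangleTorusLadder.lean`, `TriangleTorusImbalance.lean`; NOT progress on ω.

This file is the purely algebraic layer of the gauge-fixed Conway–Lagarias invariant (RESULTS-g32 §1, here in integer
coordinates of the `A₂` lattice `ℤ²` with the area form `det₂` and the rotation `rot 1 = ρ` of order `3`, `1 + ρ + ρ² = 0`):
* `Heis` — the discrete Heisenberg group `(v, a)·(w, b) = (v + w, a + b + det₂ v w)` (a `Group`), central elements `cen k`,
  step elements `st s`, the holonomy `hol L = ∏ st sᵢ` of a step list (`hol (L ++ L') = hol L * hol L'`), and the action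
  `rotH t` of `ℤ/3` by rotating the vector part (a group automorphism; `hol (L.map (rot t)) = rotH t (hol L)`).
* `Q t g = 3·a + det₂ v (rot t v)` — the "three-period area" functional: for a `T`-periodic walk whose consecutive periods are
  rotated by `ρ_T = rot t ≠ 1`, three periods close up and `Q` is (a fixed multiple of) the area of the closed shadow polygon.
  Its four structural properties, all polynomial identities proved by `ring`:
  `Q_conj` (`Q t (st s * g * (st (rot t s))⁻¹) = Q t g`: independence of the cross-rung),
  `Q_mul_cen` (`Q t (g * cen k) = Q t g + 3k`: each stone shifts `Q` by a constant),
  `Q_hol_append_rotate` (`Q t (hol (X ++ Y)) = Q t (hol (Y ++ X.map (rot t)))`: independence of the base point of the period),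
  `Q_rotH` (invariance under a global rotation) and `Q_mul_left` (the hole defect: left multiplication by a loop `(c, a)`
  changes `Q` by the affine function `3a + det₂ c (ρc) + (3 det₂ c v + det₂ c (ρv) + det₂ v (ρc))` of `v`).
* `Q_window` — consequently, for a slot sequence `f : ℤ → List (ℤ × ℤ)` with `f (k + P) = (f k).map (rot t)`, the value
  `Q t (hol (f a ++ f (a+1) ++ ⋯ ++ f (a+P−1)))` does not depend on the window start `a`.
-/

namespace Summit.MatrixMultiplication.OmegaCensus.TriangleTorus

/-- The area form (determinant) on `ℤ²`. [folklore] -/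
def det₂ (v w : ℤ × ℤ) : ℤ := v.1 * w.2 - v.2 * w.1

/-- `det₂` in coordinates. [folklore] -/
@[simp] theorem det₂_mk (a b c d : ℤ) : det₂ (a, b) (c, d) = a * d - b * c := rfl

/-- [folklore] -/
@[simp] theorem det₂_zero_left (v : ℤ × ℤ) : det₂ 0 v = 0 := by simp [det₂]

/-- [folklore] -/
@[simp] theorem det₂_zero_right (v : ℤ × ℤ) : det₂ v 0 = 0 := by simp [det₂]

/-- [folklore] -/
@[simp] theorem det₂_self (v : ℤ × ℤ) : det₂ v v = 0 := by simp [det₂]; ring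

/-- An element of the discrete Heisenberg group: a lattice vector `v` and an area coordinate `a`. [folklore] -/
@[ext] structure Heis where
  /-- vector part -/
  v : ℤ × ℤ
  /-- central (area) part -/
  a : ℤ
  deriving DecidableEq

namespace Heis

/-- Heisenberg multiplication `(v, a)·(w, b) = (v + w, a + b + det₂ v w)`. [folklore] -/
instance : Mul Heis := ⟨fun g h => ⟨g.v + h.v, g.a + h.a + det₂ g.v h.v⟩⟩
/-- The identity `(0, 0)`. [folklore] -/
instance : One Heis := ⟨⟨0, 0⟩⟩
/-- The inverse `(v, a)⁻¹ = (−v, −a)` (as `det₂ v v = 0`). [folklore] -/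
instance : Inv Heis := ⟨fun g => ⟨-g.v, -g.a⟩⟩

/-- Vector part of a product. [folklore] -/
@[simp] theorem mul_v (g h : Heis) : (g * h).v = g.v + h.v := rfl
/-- Area part of a product. [folklore] -/
@[simp] theorem mul_a (g h : Heis) : (g * h).a = g.a + h.a + det₂ g.v h.v := rfl
/-- Vector part of `1`. [folklore] -/
@[simp] theorem one_v : (1 : Heis).v = 0 := rfl
/-- Area part of `1`. [folklore] -/
@[simp] theorem one_a : (1 : Heis).a = 0 := rfl
/-- Vector part of the inverse. [folklore] -/
@[simp] theorem inv_v (g : Heis) : g⁻¹.v = -g.v := rfl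
/-- Area part of the inverse. [folklore] -/
@[simp] theorem inv_a (g : Heis) : g⁻¹.a = -g.a := rfl

/-- `Heis` is a group. [folklore] -/
instance : Group Heis := Group.ofLeftAxioms
  (fun g h k => by
    obtain ⟨⟨a, b⟩, x⟩ := g; obtain ⟨⟨c, d⟩, y⟩ := h; obtain ⟨⟨e, f⟩, z⟩ := k
    ext <;> simp <;> ring)
  (fun g => by obtain ⟨⟨a, b⟩, x⟩ := g; ext <;> simp)
  (fun g => by obtain ⟨⟨a, b⟩, x⟩ := g; ext <;> simp; ring)

end Heis

open Heis

/-- The central element with area `k`. [folklore] -/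
def cen (k : ℤ) : Heis := ⟨0, k⟩

/-- The step element of a lattice vector. [folklore] -/
def st (s : ℤ × ℤ) : Heis := ⟨s, 0⟩

/-- [folklore] -/
@[simp] theorem cen_v (k : ℤ) : (cen k).v = 0 := rfl
/-- [folklore] -/
@[simp] theorem cen_a (k : ℤ) : (cen k).a = k := rfl
/-- [folklore] -/
@[simp] theorem st_v (s : ℤ × ℤ) : (st s).v = s := rfl
/-- [folklore] -/
@[simp] theorem st_a (s : ℤ × ℤ) : (st s).a = 0 := rfl

/-- Central elements commute with everything. [folklore] -/
theorem mul_cen_comm (g : Heis) (k : ℤ) : g * cen k = cen k * g := by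
  ext <;> simp [cen]; ring

/-- [folklore] -/
theorem cen_add (k l : ℤ) : cen (k + l) = cen k * cen l := by
  ext <;> simp [cen]

/-- [folklore] -/
@[simp] theorem cen_zero : cen 0 = 1 := by ext <;> simp [cen]

/-- A step followed by its reverse is trivial (backtracking is invisible to the holonomy). [folklore] -/
@[simp] theorem st_mul_st_neg (s : ℤ × ℤ) : st s * st (-s) = 1 := by
  obtain ⟨a, b⟩ := s; ext <;> simp [st]; ring

/-- [folklore] -/
@[simp] theorem st_neg_mul_st (s : ℤ × ℤ) : st (-s) * st s = 1 := by
  obtain ⟨a, b⟩ := s; ext <;> simp [st]; ring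

/-- [folklore] -/
@[simp] theorem st_mul_st_neg_mul (s : ℤ × ℤ) (g : Heis) : st s * (st (-s) * g) = g := by
  rw [← mul_assoc, st_mul_st_neg, one_mul]

/-- [folklore] -/
@[simp] theorem st_neg_mul_st_mul (s : ℤ × ℤ) (g : Heis) : st (-s) * (st s * g) = g := by
  rw [← mul_assoc, st_neg_mul_st, one_mul]

/-- [folklore] -/
theorem st_inv (s : ℤ × ℤ) : (st s)⁻¹ = st (-s) := by
  rw [inv_eq_iff_mul_eq_one, st_mul_st_neg]

/-- The holonomy of a step list: the ordered product of its step elements. [folklore] -/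
def hol (L : List (ℤ × ℤ)) : Heis := (L.map st).prod

/-- [folklore] -/
@[simp] theorem hol_nil : hol [] = 1 := rfl

/-- [folklore] -/
@[simp] theorem hol_cons (s : ℤ × ℤ) (L : List (ℤ × ℤ)) : hol (s :: L) = st s * hol L := by
  simp [hol]

/-- [folklore] -/
@[simp] theorem hol_append (L L' : List (ℤ × ℤ)) : hol (L ++ L') = hol L * hol L' := by
  simp [hol]

/-- [folklore] -/
theorem hol_singleton (s : ℤ × ℤ) : hol [s] = st s := by simp

/-! ## The rotation of order three -/

/-- The rotation `ρ` by `120°` of the `A₂` lattice in skew coordinates: `ρ(x, y) = (−x − y, x)`. [folklore] -/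
def rotM (v : ℤ × ℤ) : ℤ × ℤ := (-v.1 - v.2, v.1)

/-- `rot t = ρ^t` for `t : ZMod 3`. [folklore] -/
def rot (t : ZMod 3) (v : ℤ × ℤ) : ℤ × ℤ := match t with
  | 0 => v
  | 1 => rotM v
  | 2 => rotM (rotM v)

/-- [folklore] -/
@[simp] theorem rot_zero (v : ℤ × ℤ) : rot 0 v = v := rfl

/-- `ρ^t` is additive. [folklore] -/
theorem rot_add_vec (t : ZMod 3) (v w : ℤ × ℤ) : rot t (v + w) = rot t v + rot t w := by
  obtain ⟨x, y⟩ := v; obtain ⟨x', y'⟩ := w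
  fin_cases t <;> ext <;> simp [rot, rotM] <;> ring

/-- [folklore] -/
theorem rot_neg_vec (t : ZMod 3) (v : ℤ × ℤ) : rot t (-v) = -rot t v := by
  obtain ⟨x, y⟩ := v
  fin_cases t <;> ext <;> simp [rot, rotM] <;> ring

/-- `ρ^t` in terms of its values on the basis. [folklore] -/
theorem rot_eq_basis (t : ZMod 3) (x y : ℤ) :
    rot t (x, y) = (x * (rot t (1, 0)).1 + y * (rot t (0, 1)).1, x * (rot t (1, 0)).2 + y * (rot t (0, 1)).2) := by
  fin_cases t <;> ext <;> simp [rot, rotM] <;> ring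

/-- `ρ^{a+b} = ρ^a ρ^b`. [folklore] -/
theorem rot_add (a b : ZMod 3) (v : ℤ × ℤ) : rot (a + b) v = rot a (rot b v) := by
  -- on the basis this is a finite computation; extend by linearity
  have key : ∀ a b : ZMod 3, rot (a + b) (1, 0) = rot a (rot b (1, 0)) ∧ rot (a + b) (0, 1) = rot a (rot b (0, 1)) := by
    decide
  obtain ⟨x, y⟩ := v
  rw [rot_eq_basis (a + b), (key a b).1, (key a b).2, rot_eq_basis b x y]
  generalize rot b (1, 0) = p
  generalize rot b (0, 1) = q
  obtain ⟨p₁, p₂⟩ := p; obtain ⟨q₁, q₂⟩ := q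
  rw [rot_eq_basis a p₁ p₂, rot_eq_basis a q₁ q₂, rot_eq_basis a (x * p₁ + y * q₁)]
  ext <;> simp <;> ring

/-- Rotations commute. [folklore] -/
theorem rot_comm (a b : ZMod 3) (v : ℤ × ℤ) : rot a (rot b v) = rot b (rot a v) := by
  rw [← rot_add, add_comm, rot_add]

/-- [folklore] -/
@[simp] theorem rot_zero_vec (t : ZMod 3) : rot t 0 = 0 := by
  fin_cases t <;> rfl

/-- `ρ^t` preserves the area form. [folklore] -/
theorem det₂_rot (t : ZMod 3) (v w : ℤ × ℤ) : det₂ (rot t v) (rot t w) = det₂ v w := by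
  obtain ⟨x, y⟩ := v; obtain ⟨x', y'⟩ := w
  fin_cases t <;> simp [rot, rotM] <;> ring

/-- `1 + ρ + ρ² = 0`: three consecutive periods of a twisted-periodic walk close up. [folklore] -/
theorem rot_sum_three (t : ZMod 3) (ht : t ≠ 0) (v : ℤ × ℤ) : v + rot t v + rot t (rot t v) = 0 := by
  obtain ⟨x, y⟩ := v
  fin_cases t
  · exact absurd rfl ht
  · ext <;> simp [rot, rotM] <;> ring
  · ext <;> simp [rot, rotM]; ring

/-- The rotation acting on the Heisenberg group (vector part rotated, area fixed). [folklore] -/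
def rotH (t : ZMod 3) (g : Heis) : Heis := ⟨rot t g.v, g.a⟩

/-- [folklore] -/
@[simp] theorem rotH_v (t : ZMod 3) (g : Heis) : (rotH t g).v = rot t g.v := rfl
/-- [folklore] -/
@[simp] theorem rotH_a (t : ZMod 3) (g : Heis) : (rotH t g).a = g.a := rfl

/-- `rotH t` is multiplicative. [folklore] -/
theorem rotH_mul (t : ZMod 3) (g h : Heis) : rotH t (g * h) = rotH t g * rotH t h := by
  ext1
  · simp [rot_add_vec]
  · simp [det₂_rot]

/-- [folklore] -/
@[simp] theorem rotH_one (t : ZMod 3) : rotH t 1 = 1 := by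
  ext1 <;> simp

/-- [folklore] -/
@[simp] theorem rotH_st (t : ZMod 3) (s : ℤ × ℤ) : rotH t (st s) = st (rot t s) := by
  ext1 <;> simp [st, rotH]

/-- [folklore] -/
@[simp] theorem rotH_cen (t : ZMod 3) (k : ℤ) : rotH t (cen k) = cen k := by
  ext1 <;> simp [cen, rotH]

/-- Rotating every step rotates the holonomy. [folklore] -/
theorem hol_map_rot (t : ZMod 3) (L : List (ℤ × ℤ)) : hol (L.map (rot t)) = rotH t (hol L) := by
  induction L with
  | nil => simp
  | cons s L ih => simp [ih, rotH_mul]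

/-- The vector part of a holonomy is the sum of the steps. [folklore] -/
theorem hol_v_eq_sum (L : List (ℤ × ℤ)) : (hol L).v = L.sum := by
  induction L with
  | nil => simp
  | cons s L ih => simp [ih]

/-! ## The three-period functional `Q` -/

/-- `Q t (v, a) = 3a + det₂ v (ρ^t v)`: for `t ≠ 0`, the area of the closed polygon formed by three consecutive periods
`(v,a), ρ^t(v,a), ρ^{2t}(v,a)` (up to the normalisation of this file). [folklore] -/
def Q (t : ZMod 3) (g : Heis) : ℤ := 3 * g.a + det₂ g.v (rot t g.v)

/-- Each stone shifts `Q` by three times its central charge. [folklore] -/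
theorem Q_mul_cen (t : ZMod 3) (g : Heis) (k : ℤ) : Q t (g * cen k) = Q t g + 3 * k := by
  simp only [Q, mul_a, cen_a, mul_v, cen_v, add_zero, det₂_zero_right]; ring

/-- `Q` is invariant under a global rotation. [folklore] -/
theorem Q_rotH (t u : ZMod 3) (g : Heis) : Q t (rotH u g) = Q t g := by
  simp only [Q, rotH_a, rotH_v]
  rw [rot_comm t u, det₂_rot]

/-- **Cross-rung independence.** Conjugating by a rung `s` at the start and its translate `ρ^t s` at the end of a period does
not change `Q` (`t ≠ 0`). [folklore] -/
theorem Q_conj (t : ZMod 3) (ht : t ≠ 0) (s : ℤ × ℤ) (g : Heis) :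
    Q t (st s * g * (st (rot t s))⁻¹) = Q t g := by
  obtain ⟨x, y⟩ := s
  obtain ⟨⟨p, q⟩, a⟩ := g
  fin_cases t
  · exact absurd rfl ht
  · simp [Q, st, rot, rotM]; ring
  · simp [Q, st, rot, rotM]; ring

/-- **Base-point independence.** Moving a prefix `X` of the period to the end (where it reappears rotated by `ρ^t`) does
not change `Q` (`t ≠ 0`). [folklore] -/
theorem Q_hol_append_rotate (t : ZMod 3) (ht : t ≠ 0) (X Y : List (ℤ × ℤ)) :
    Q t (hol (X ++ Y)) = Q t (hol (Y ++ X.map (rot t))) := by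
  rw [hol_append, hol_append, hol_map_rot]
  generalize hol X = g
  generalize hol Y = h
  obtain ⟨⟨p, q⟩, a⟩ := g
  obtain ⟨⟨p', q'⟩, b⟩ := h
  fin_cases t
  · exact absurd rfl ht
  · simp [Q, rot, rotM, rotH]; ring
  · simp [Q, rot, rotM, rotH]; ring

/-- **Hole defect.** Left multiplication by a loop element `(c, a)` changes `Q` by an affine function of the vector part.
[folklore] -/
theorem Q_mul_left (t : ZMod 3) (l g : Heis) :
    Q t (l * g) = Q t g + (3 * l.a + det₂ l.v (rot t l.v)) +
      (3 * det₂ l.v g.v + det₂ l.v (rot t g.v) + det₂ g.v (rot t l.v)) := by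
  obtain ⟨⟨p, q⟩, a⟩ := g
  obtain ⟨⟨c, d⟩, b⟩ := l
  fin_cases t <;> simp [Q, rot, rotM] <;> ring

/-! ## Windows of a twisted-periodic slot sequence -/

/-- Concatenation of the slots `f a, f (a+1), …, f (a+m-1)` of a `ℤ`-indexed family of step lists. [folklore] -/
def lconcat (f : ℤ → List (ℤ × ℤ)) (a : ℤ) : ℕ → List (ℤ × ℤ)
  | 0 => []
  | m + 1 => lconcat f a m ++ f (a + m)

/-- [folklore] -/
@[simp] theorem lconcat_zero (f : ℤ → List (ℤ × ℤ)) (a : ℤ) : lconcat f a 0 = [] := rfl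

/-- [folklore] -/
theorem lconcat_succ (f : ℤ → List (ℤ × ℤ)) (a : ℤ) (m : ℕ) :
    lconcat f a (m + 1) = lconcat f a m ++ f (a + m) := rfl

/-- Splitting a window after its first `m` slots. [folklore] -/
theorem lconcat_add (f : ℤ → List (ℤ × ℤ)) (a : ℤ) (m k : ℕ) :
    lconcat f a (m + k) = lconcat f a m ++ lconcat f (a + m) k := by
  induction k with
  | zero => simp
  | succ k ih =>
    rw [← Nat.add_assoc, lconcat_succ, ih, lconcat_succ, List.append_assoc]
    congr 2; push_cast; ring_nf

/-- Peeling off the first slot. [folklore] -/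
theorem lconcat_succ' (f : ℤ → List (ℤ × ℤ)) (a : ℤ) (m : ℕ) :
    lconcat f a (m + 1) = f a ++ lconcat f (a + 1) m := by
  rw [Nat.add_comm, lconcat_add]
  simp [lconcat_succ]

/-- Pointwise agreement on the window gives equal concatenations. [folklore] -/
theorem lconcat_congr {f g : ℤ → List (ℤ × ℤ)} {a b : ℤ} {m : ℕ} (h : ∀ i : ℕ, i < m → f (a + i) = g (b + i)) :
    lconcat f a m = lconcat g b m := by
  induction m with
  | zero => rfl
  | succ m ih =>
    rw [lconcat_succ, lconcat_succ, ih fun i hi => h i (Nat.lt_succ_of_lt hi), h m (Nat.lt_succ_self m)]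

/-- Mapping over a window. [folklore] -/
theorem lconcat_map (f : ℤ → List (ℤ × ℤ)) (φ : ℤ × ℤ → ℤ × ℤ) (a : ℤ) (m : ℕ) :
    (lconcat f a m).map φ = lconcat (fun k => (f k).map φ) a m := by
  induction m with
  | zero => rfl
  | succ m ih => rw [lconcat_succ, lconcat_succ, List.map_append, ih]

/-- Length of a window is the sum of the slot lengths; in particular a uniform bound. [folklore] -/
theorem length_lconcat_le (f : ℤ → List (ℤ × ℤ)) (a : ℤ) (m B : ℕ) (h : ∀ k, (f k).length ≤ B) :
    (lconcat f a m).length ≤ m * B := by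
  induction m with
  | zero => simp
  | succ m ih =>
    rw [lconcat_succ, List.length_append, Nat.succ_mul]
    exact Nat.add_le_add ih (h _)

/-- Re-bracketing a window of pairs of slots as a window of slots: if `g j = f (2j + b) ++ f (2j + b + 1)` then
`g a ++ ⋯ ++ g (a+m-1) = f (2a+b) ++ ⋯ ++ f (2a+b+2m-1)`. [folklore] -/
theorem lconcat_pairs (f g : ℤ → List (ℤ × ℤ)) (b : ℤ) (hg : ∀ j, g j = f (2 * j + b) ++ f (2 * j + b + 1))
    (a : ℤ) (m : ℕ) : lconcat g a m = lconcat f (2 * a + b) (2 * m) := by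
  induction m with
  | zero => rfl
  | succ m ih =>
    rw [lconcat_succ, ih, hg, show 2 * (m + 1) = 2 * m + 1 + 1 by ring, lconcat_succ, lconcat_succ, List.append_assoc]
    congr 3
    · push_cast; ring
    · push_cast; ring

/-- **Window lemma.** For a slot sequence that is `P`-periodic up to the rotation `ρ^t` (`t ≠ 0`), the three-period functional
of a window of `P` consecutive slots does not depend on where the window starts. [folklore] -/
theorem Q_window (t : ZMod 3) (ht : t ≠ 0) (f : ℤ → List (ℤ × ℤ)) (P : ℕ)
    (hf : ∀ k, f (k + P) = (f k).map (rot t)) (a b : ℤ) :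
    Q t (hol (lconcat f a P)) = Q t (hol (lconcat f b P)) := by
  -- one step up
  have step : ∀ a : ℤ, Q t (hol (lconcat f (a + 1) P)) = Q t (hol (lconcat f a P)) := by
    intro a
    cases P with
    | zero => simp
    | succ m =>
      rw [lconcat_succ, lconcat_succ' f a m, Q_hol_append_rotate t ht (f a)]
      congr 3
      rw [← hf a]; congr 1; push_cast; ring
  -- iterate in both directions
  have up : ∀ (k : ℕ) (a : ℤ), Q t (hol (lconcat f (a + k) P)) = Q t (hol (lconcat f a P)) := by
    intro k
    induction k with
    | zero => intro a; simp
    | succ k ih => intro a; rw [show a + (k + 1 : ℕ) = (a + k) + 1 by push_cast; ring, step, ih]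
  rcases le_total a b with hab | hab
  · obtain ⟨k, rfl⟩ : ∃ k : ℕ, b = a + k := ⟨(b - a).toNat, by omega⟩
    exact (up k a).symm
  · obtain ⟨k, rfl⟩ : ∃ k : ℕ, a = b + k := ⟨(a - b).toNat, by omega⟩
    exact up k b

end Summit.MatrixMultiplication.OmegaCensus.TriangleTorus
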